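import Summits.BirchSwinnertonDyer.BirchSwinnertonDyer.Theorems.GoldfeldAllTwistsTwoConverseTwinQuarterTraceIndexB4POneAlphaSharp
import Summits.BirchSwinnertonDyer.BirchSwinnertonDyer.Theorems.GoldfeldAllTwistsTwoConverseTwinAdditiveTwoPrimesTwistDescentSharpPlusPOneAlpha
import Summits.BirchSwinnertonDyer.BirchSwinnertonDyer.Theorems.GoldfeldAllTwistsTwoConverseTwinAdditiveTwoPrimesTwistDescentSharpPlusPFiveAlpha
import Summits.BirchSwinnertonDyer.BirchSwinnertonDyer.Theorems.GoldfeldAllTwistsTwoConverseTwinAdditiveTwoPrimesTwistHalvabilityPlusPOneAlpha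
import Summits.BirchSwinnertonDyer.BirchSwinnertonDyer.Theorems.GoldfeldAllTwistsTwoConverseTwinAdditiveTwoPrimesTwistHalvabilityPlusPFiveAlpha
import Summits.BirchSwinnertonDyer.BirchSwinnertonDyer.Theorems.GoldfeldAllTwistsTwoConverseTwinQuarterTraceChiZTraceAlphaPlus
import Summits.BirchSwinnertonDyer.BirchSwinnertonDyer.Theorems.GoldfeldAllTwistsTwoConverseTwinQuarterTraceAlphaPlusOfPrint
import HarnessLib

set_option linter.dupNamespace false -- namespace `…BirchSwinnertonDyer.BirchSwinnertonDyer…` is the cell's (D-0017 nested layout)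
set_option autoImplicit false

/-!
# ORDER (ccclxxxii) tranche F⁺ file F⁺-3: `…QuarterTraceIndexB4PlusAlphaSharp` — **`BSD(W, 2)` ON OBJECT A7⁺** (cells a71+ / a75+: TYPE α, `q ≡ 7 (8)`,
# `(q/7) = −1`; `p ≡ 1 / 5 (8)`, `(−7/p) = +1`, `−7 ∉ 𝔽_p^{×4}`; **`(p/q) = +1`**) for every globally minimal `W ≅ X₀(49)^{(−2qp)}`, from SEVENTEEN named
# inputs (Z3's SIXTEEN + Kolyvagin `hKo`), WITHOUT Cassels–Tate, WITHOUT `h13`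

Cell `bsd-goldfeld`, seat `bsd-goldfeld-s1p-c3x` (gen 15). PLUS TWIN of C7A-F3 `…QuarterTraceIndexB4POneAlphaSharp` (road verbatim): the SHARP descent
(`…DescentSharpPlus{POne,PFive}Alpha`: `Ш(W)[2] = 0` from `#S ≤ 2`, `#S′ ≤ 4`, rank `1` — fact-free, NO `hCT`), `bsdp_two_iff_shaAn_unit_of_forall_mem_sha`,
the `#Ш_an` bookkeeping `shaAn_eq_x049HeegnerTwistQuotient_of_heegner` with ITS `k`, `k = 1` by F⁺-2 `not_forall_halvable_twoPrimesTwist_plus{POne,PFive}Alpha`,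
and `padicValRat_x049Quotient_eq_zero_of_halvingExactlyOnce` on the trace re-export F⁺-1 `trace_halvingExactlyOnce_negEightTwoPrimes_alphaPlus{POne,PFive}_of_print`
(the χ_Z channel at `σ̃_q`); rank / analytic rank from Z⁺-2 `analyticRank_eq_one_twoPrimesTwist_alphaPlus{POne,PFive}_of_print`. §1 a71+, §2 a75+: each
`bsdp_two_negTwoPrimesTwist_of_traceHalving_plus…_sharp` (the road) + `bsdp_two_negTwoPrimesTwist_alphaPlus…_of_print_sharp` (the closer; SEVENTEEN named
binders BY NAME: `hCST hGZ h12 h44 h14 hS31 hnew hM hBT hBF hGZK hEta hEta₀ hD hBCST hpar` + `hKo`). `--supports stmt-BirchSwinnertonDyer-19140 --as helper`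
(formula axis). Theses-free; theorems only; no definition, no new fact, no `sorry`. FRONTIER-grade: twist-density ZERO modulo named print; twin″ (item 19140)
is NOT closed; never distance-to-summit. HONEST FRAMING: BSD is not proved by any of this.
-/


noncomputable section

open scoped Classical IntermediateField

open WeierstrassCurve NumberField Literature.NumberTheory Literature.NumberTheory.EllipticCurves
  Literature.NumberTheory.EllipticCurves.ModularForms Literature.NumberTheory.EllipticCurves.CaiShuTian2014
  Literature.NumberTheory.EllipticCurves.CoatesLiTianZhai2015 WeierstrassCurve.QuadraticDescent
  Summit.BirchSwinnertonDyer.Rank1Residual.P2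

namespace Summit.BirchSwinnertonDyer.BirchSwinnertonDyer.Theorems.GoldfeldGoodTwists

/-! ## §1 The common road and the closer on a71+ (TYPE α, `p ≡ 1 (8)`, `(p/q) = +1`), without Cassels–Tate -/

section ClosersPOne
-- the cell's point-group world over `K[1]` / `ℂ` (G5's / «C7 −hCT» file 3's, verbatim); section-local. No `omega`/`decide` below.
attribute [local instance 2000] Classical.propDecidable

/-- **THE COMMON ROAD OF THEOREM B⁗ ON CELL a71+ (TYPE α), WITHOUT CASSELS–TATE** — «C7 −hCT» file 3's road verbatim with the TYPE-α `k = 1` file F1 (prints: `hGZ h12 hnew hBF hKo hGZK hM` only — the five prints `hCST h44 h13 h14 hS31`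
that G5's road carried solely for F11′ are gone with `hCT`). `W` globally minimal with `C • W = X₀(49)^{(−2qp)}`, `q ≡ 7 (mod 8)` prime, `(q/7) = −1`, `p ≡ 1 (mod 8)` prime,
`(−7/p) = 1`, `−7` NOT a fourth power mod `p`, `(p/q) = +1` (`hq8 hq7 hp8 hp7 hα hpq`),
`r_an(W) = rank W(ℚ) = 1`, and halving-exactly-once for the explicit trace over every imaginary quadratic `K` with `d_K = −8qp` (`htrace`, the
shape of the T3-I trace re-export) ⇒ `BSD(W, 2)`: the SHARP descent (`…TwinAdditiveTwoPrimesTwistDescentSharpPOne`: `Ш(W)[2] = 0` from `#S ≤ 2`, `#S′ ≤ 4`, rank `1` — fact-free, NO `hCT`) ⇒ `BSD(W,2) ⟺ ord₂ #Ш_an = 0`; `K = ℚ(√−2qp)`, a Heegner point (`hnew`),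
`Cd • X₀(49)^{(d_K)} = W`; `#Ш_an = 𝔮₄₉` with ITS `k`, `k = 1` (F1 `not_forall_halvable_twoPrimesTwist_plusPOneAlpha`, the TYPE-α F12a with `S′ ⊆ {1, −7, p, −7p}`); the optimal datum (`hM`), the trace relation, the factor table.
[cite: Miller2011LMS, Def. 1.1] [cite: GrossZagier1986, Thm. I.(6.3) and V.§2] [cite: BurungaleFlach2024, Cor. 2] [cite: GrossLMS1991, §4 (4.1)] -/
theorem bsdp_two_negTwoPrimesTwist_of_traceHalving_plusPOneAlpha_sharp
    (hGZ : ∀ (N : ℕ) [NeZero N] (W : WeierstrassCurve ℚ) (K : Type) [Field K] [NumberField K], gross_zagier N W K)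
    (h12 : thm12_fullBSD_twist) (hnew : exists_isNewformOf) (hBF : bsdTriple_of_hasCM_of_L_one_ne_zero)
    (hKo : ∀ (N : ℕ) [NeZero N] (W : WeierstrassCurve ℚ) (K : Type) [Field K] [NumberField K], kolyvagin N W K)
    (hGZK : rank_eq_analyticRank_of_analyticRank_le_one) (hM : OptimalCurveManinCertificate cm7)
    {q p : ℕ} [Fact q.Prime] [Fact p.Prime] (hq8 : q % 8 = 7) (hq7 : jacobiSym q 7 = -1) (hp8 : p % 8 = 1) (hp7 : legendreSym p (-7) = 1)
    (hα : ¬ ∃ x : ZMod p, x ^ 4 = -7) (hpq : jacobiSym p q = 1)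
    (W : WeierstrassCurve ℚ) [W.IsElliptic] [W.IsGloballyMinimal] (C : VariableChange ℚ)
    (hC : C • W = cm7.quadraticTwist ((-2 * ((q : ℤ) * p) : ℤ) : ℚ)) (har : W.analyticRank = 1) (hrk : W.mordellWeilRank = 1)
    (htrace : ∀ (K : Type) [Field K] [NumberField K], IsImaginaryQuadratic K → NumberField.discr K = -(8 * (q : ℤ) * p) →
      ∀ (ι : K →+* ℂ) [FiniteDimensional K (ringClassField K ι 1)] [IsGalois K (ringClassField K ι 1)]
        (D₀ : ModularParametrizationData cm7 49), |D₀.c| = 1 → ∀ (β : ℤ) (d : KolyvaginHeegnerData D₀ β ι 1),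
        ∃ y : (cm7.baseChange K).toAffine.Point,
          Affine.Point.map (W' := cm7) (algebraMap K (ringClassField K ι 1)).toRatAlgHom y =
            ∑ σ : ringClassField K ι 1 ≃ₐ[K] ringClassField K ι 1,
              Affine.Point.map (σ : ringClassField K ι 1 →ₐ[K] ringClassField K ι 1) d.y ∧
          (∃ (N : ℤ) (R₀ : (cm7.baseChange K).toAffine.Point), Odd N ∧ N • y = (2 : ℤ) • R₀) ∧
          ¬ ∃ (S : (cm7.baseChange K).toAffine.Point) (N' : ℤ) (t' : (cm7.baseChange K).toAffine.Point), Odd N' ∧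
              (t' = 0 ∨ t' = Affine.Point.some 2 (-1) (nonsingular_cm7_baseChange_two_neg_one K)) ∧ N' • y = (4 : ℤ) • S + t') :
    BSDp W 2 := by
  haveI : cm7.IsGloballyMinimal := Summit.BirchSwinnertonDyer.Rank1Residual.X12.O11.RouteU.isGloballyMinimal_X049_eq
  have hq : q.Prime := Fact.out
  have hp : p.Prime := Fact.out
  obtain ⟨hq4, -⟩ := mod_eight_seven_arith hq8
  obtain ⟨-, hq2, -, -⟩ := mod_four_three_split hq4
  obtain ⟨hp2, -, hp7', hp4⟩ := aux_of_mod_eight_one hp8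
  obtain ⟨-, hqp, -, -, -⟩ := arith_negEightTwoPrimes_modFour hq4 hp4
  obtain ⟨hodd, hneg⟩ := cells_arith_negEightTwoPrimes_pOne hq4 hp4
  have hpj : jacobiSym p 7 = 1 := by rw [← legendreSym_neg_seven_eq_jacobiSym hp2]; exact hp7
  have hCq : C • W = cm7.quadraticTwist (-(2 * (q : ℚ) * p)) := by rw [hC]; push_cast; ring_nf
  have h2 : ∀ c ∈ W.sha, 2 • c = 0 → c = 0 := (rank_le_one_and_sha_two_twoPrimesTwist_plusPOneAlpha hq8 hq7 hp8 hp7 hα hpq W C hC).2 hrk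
  obtain ⟨-, hiff⟩ := bsdp_two_iff_shaAn_unit_of_forall_mem_sha W h2 (hrk.trans har.symm)
  ------------------------------------------------------------------ `K = ℚ(√−2qp)`, a Heegner point, `Cd • X₀(49)^{(d_K)} = W`
  have hsq : Squarefree (-(2 * ((q : ℤ) * p))) := squarefree_neg_two_mul_two_primes hq hp hq2 hp2 hqp
  obtain ⟨h4dvd, hmod4, hdiv⟩ := discr_arith_negEight_odd hodd
  obtain ⟨K, _, _, h2K, hdK⟩ := QuadraticFields.Quadratic.exists_numberField_discr_eq (D := 4 * (-(2 * ((q : ℤ) * p))))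
    (Or.inr ⟨h4dvd, hmod4, by rw [hdiv]; exact hsq⟩)
  have hK : IsImaginaryQuadratic K := isImaginaryQuadratic_iff_discr_neg.mpr ⟨h2K, by rw [hdK]; exact hneg⟩
  have hdK' : NumberField.discr K = -(8 * (q : ℤ) * p) := by rw [hdK]; ring
  have hdK8 : NumberField.discr K = -(8 * ((q * p : ℕ) : ℤ)) := by rw [hdK]; push_cast; ring
  haveI : NeZero (cm7.conductorNorm ℤ) := ⟨(cm7.conductorNorm_pos_holds).ne'⟩
  have hH : SatisfiesHeegnerHypothesis 49 K := satisfiesHeegnerHypothesis_fortyNine_negEightTwoPrimes hK hq7 hpj hdK'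
  have hH' : SatisfiesHeegnerHypothesis (cm7.conductorNorm ℤ) K := by rw [conductorNorm_cm7]; exact hH
  obtain ⟨P, hP0⟩ := exists_isHeegnerPoint_of_exists_isNewformOf_of_maninConstant cm7 K hnew
    IsNewformOf.exists_maninConstant_ne_zero_holds hK hH'
  obtain ⟨Dt, H, ι, hPH⟩ := isHeegnerPoint_of_level_eq conductorNorm_cm7 hP0
  obtain ⟨Cd, hCd⟩ := exists_smul_twist_discr_eq_of_smul_eq_twist_negTwo K hdK8 W C (by rw [hC]; push_cast; ring_nf)
  ------------------------------------------------------------------ `#Ш_an = 𝔮₄₉` with ITS `k`, and `k = 1`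
  obtain ⟨-, hrK, -, k, hk12, hkiff, hsha⟩ := shaAn_eq_x049HeegnerTwistQuotient_of_heegner hnew h12 hBF hGZ hKo hGZK K hK hH
    Dt H ι P hPH W Cd hCd har
  have hk1 : k = 1 := by
    rcases hk12 with h | h
    · exact h
    · exact absurd (hkiff.mp h) (not_forall_halvable_twoPrimesTwist_plusPOneAlpha hK hq8 hq7 hp8 hp7 hα hpq hdK' W C hC hrk)
  rw [hk1] at hsha
  refine hiff.mpr ⟨_, hsha, ?_⟩
  ------------------------------------------------------------------ the trace of the optimal datum: `P = (D₀.c·Dt.c) • y`, `y` halved exactly once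
  obtain ⟨hN, D, -, hD', -⟩ := hM.exists_optimalDatum_abs_maninConstant_eq_one
  haveI := hN
  obtain ⟨D₀, hc⟩ := exists_datum_abs_c_eq_one_of_level_eq conductorNorm_cm7 D hD'
  obtain ⟨d⟩ := exists_kolyvaginHeegnerData_one (phi_heegnerTau_mem_singularModuliField_holds 49 cm7 K) hK D₀ H.β ι H.dvd_sq_sub
  obtain ⟨hfd, hgal⟩ := finiteDimensional_and_isGalois_ringClassField hK ι one_ne_zero
  haveI := hfd
  haveI := hgal
  obtain ⟨y, hy, hhalf, hno4⟩ := htrace K hK hdK' ι D₀ hc H.β d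
  obtain ⟨-, htr⟩ := map_eq_zsmul_sum_algEquiv_of_abs_c_eq_one (heegnerPointOfConductor_one_galoisConj_holds 49 cm7 K) hK hH Dt
    D₀ hc H d hPH
  rw [← hy, ← map_zsmul] at htr
  have hPy : P = (D₀.c * Dt.c) • y :=
    Affine.Point.map_injective (W' := cm7) (f := (algebraMap K (ringClassField K ι 1)).toRatAlgHom) htr
  exact padicValRat_x049Quotient_eq_zero_of_halvingExactlyOnce h12 hK hq hp hq2 hp2 hqp hp7' hq7 hpj hdK' Dt D₀ hc hPy hrK hhalf hno4
    W Cd hCd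

/-- **`BSD(W, 2)` ON CELL a71+ (TYPE α), FROM PRINT + KOLYVAGIN — SEVENTEEN named inputs, NO Cassels–Tate.** For primes `q ≡ 7 (mod 8)` with
`(q/7) = −1`, `p ≡ 1 (mod 8)` with `(−7/p) = +1`, `−7` NOT a fourth power mod `p`, `(p/q) = +1`, and EVERY globally minimal elliptic `W/ℚ` with
`C • W = X₀(49)^{(−2qp)}`: **`BSD(W, 2)`** (Miller's `2`-part), granted EXACTLY: the SIXTEEN prints of the C7A rank axis THEOREM A⁗_α(C7A)
(`hCST hGZ h12 h44 h14 hS31 hnew hM hBT hBF hGZK hEta hEta₀ hD` + `hBCST` + `hpar`; file Z3 `analyticRank_eq_one_twoPrimesTwist_alphaPlusPOne_of_print` ⇒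
`r_an = rank = 1`, and file F2 `trace_halvingExactlyOnce_negEightTwoPrimes_alphaPlusPOne_of_print` = the C7A trace re-export by the χ_Z channel) and Kolyvagin
`hKo` (the Gross–Zagier–Kolyvagin `#Ш_an` bookkeeping). NO `hCT`, NO `h13`. The road: §1's `bsdp_two_negTwoPrimesTwist_of_traceHalving_plusPOneAlpha_sharp`
(`Ш(W)[2] = 0` by the sharp descent, `k = 1` by F1). Letter-parallel to C7's `bsdp_two_negTwoPrimesTwist_betaPOne_of_print_sharp` (fifteen inputs; there
`h13` in place of `hBT hBCST hpar`). Twist-density ZERO; twin″ (item 19140) is NOT closed; BSD is not proved by any of this; not in print (the C7A cell is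
reached here by the χ_Z channel, not by a published `2`-divisibility theorem).
[cite: Miller2011LMS, Def. 1.1] [cite: GrossZagier1986, Thm. I.(6.3) and V.§2] [cite: CoatesLiTianZhai2015, Thm. 1.2 (p. 359), 1.3, 1.4 and 4.4]
[cite: BurungaleCastellaSkinnerTian2022, Thm. A (p. 326) and Rem. D (p. 327)] [cite: SilvermanAEC2009, Thm. X.4.14] -/
theorem bsdp_two_negTwoPrimesTwist_alphaPlusPOne_of_print_sharp (hCST : thm11_ringClassChar)
    (hGZ : ∀ (N : ℕ) [NeZero N] (W : WeierstrassCurve ℚ) (K : Type) [Field K] [NumberField K], gross_zagier N W K)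
    (h12 : thm12_fullBSD_twist) (h44 : thm44_ord_two_LAlg) (h14 : thm14_rankOne_twist)
    (hS31 : bsdTriple_of_rank_le_one_of_conductor_lt) (hnew : exists_isNewformOf) (hM : OptimalCurveManinCertificate cm7)
    (hBT : burungaleTian_analyticRank_eq_zero_of_selmerCorank_eq_zero_of_hasCM) (hBF : bsdTriple_of_hasCM_of_L_one_ne_zero)
    (hGZK : rank_eq_analyticRank_of_analyticRank_le_one) (hEta : x049_heegner_norm_x_sub_two_not_mem)
    (hEta₀ : x049_x_sub_two_eq_etaQuotient) (hD : deuring_etaQuotient49_heegner_generates_conjPrime)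
    (hBCST : BurungaleCastellaSkinnerTian2022.thmA_analyticRank_eq_one_of_selmerCorank_eq_one)
    (hpar : ∀ (V : WeierstrassCurve ℚ) [V.IsElliptic], p_parity V 2)
    (hKo : ∀ (N : ℕ) [NeZero N] (W : WeierstrassCurve ℚ) (K : Type) [Field K] [NumberField K], kolyvagin N W K)
    {q p : ℕ} (hq : q.Prime) (hq8 : q % 8 = 7) (hq7 : jacobiSym q 7 = -1)
    [Fact p.Prime] (hp8 : p % 8 = 1) (hp7 : legendreSym p (-7) = 1) (hα : ¬ ∃ x : ZMod p, x ^ 4 = -7) (hpq : jacobiSym (p : ℤ) q = 1)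
    (W : WeierstrassCurve ℚ) [W.IsElliptic] [W.IsGloballyMinimal] (C : VariableChange ℚ)
    (hC : C • W = cm7.quadraticTwist (-(2 * (q : ℚ) * p))) : BSDp W 2 := by
  haveI := Fact.mk hq
  obtain ⟨har, hrk, -⟩ := analyticRank_eq_one_twoPrimesTwist_alphaPlusPOne_of_print hCST hGZ h12 h44 h14 hS31 hnew hM hBT hBF hGZK hEta hEta₀ hD
    hBCST hpar hq hq8 hq7 hp8 hp7 hα hpq W C hC
  have hC' : C • W = cm7.quadraticTwist ((-2 * ((q : ℤ) * p) : ℤ) : ℚ) := by rw [hC]; push_cast; ring_nf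
  exact bsdp_two_negTwoPrimesTwist_of_traceHalving_plusPOneAlpha_sharp hGZ h12 hnew hBF hKo hGZK hM hq8 hq7 hp8 hp7 hα hpq W C
    hC' har hrk fun K _ _ hK hdK ι _ _ D₀ hc β d ↦ trace_halvingExactlyOnce_negEightTwoPrimes_alphaPlusPOne_of_print hCST hGZ h12 h44 h14
      hS31 hnew hM hBT hBF hGZK hEta hEta₀ hD hBCST hpar hq hq8 hq7 hp8 hp7 hα hpq hK hdK ι D₀ hc d

end ClosersPOne

/-! ## §2 The common road and the closer on a75+ (TYPE α, `p ≡ 5 (8)`, `(p/q) = +1`), without Cassels–Tate -/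

section ClosersPFive
-- the cell's point-group world over `K[1]` / `ℂ` (G5's / «C7 −hCT» file 3's, verbatim); section-local. No `omega`/`decide` below.
attribute [local instance 2000] Classical.propDecidable

/-- **THE COMMON ROAD OF THEOREM B⁗ ON CELL a75+ (TYPE α), WITHOUT CASSELS–TATE** — «C7 −hCT» file 3's road verbatim with the TYPE-α `k = 1` file F1 (prints: `hGZ h12 hnew hBF hKo hGZK hM` only — the five prints `hCST h44 h13 h14 hS31`
that G5's road carried solely for F11′ are gone with `hCT`). `W` globally minimal with `C • W = X₀(49)^{(−2qp)}`, `q ≡ 7 (mod 8)` prime, `(q/7) = −1`, `p ≡ 5 (mod 8)` prime,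
`(−7/p) = 1`, `−7` NOT a fourth power mod `p`, `(p/q) = +1` (`hq8 hq7 hp8 hp7 hα hpq`),
`r_an(W) = rank W(ℚ) = 1`, and halving-exactly-once for the explicit trace over every imaginary quadratic `K` with `d_K = −8qp` (`htrace`, the
shape of the T3-I trace re-export) ⇒ `BSD(W, 2)`: the SHARP descent (`…TwinAdditiveTwoPrimesTwistDescentSharpPOne`: `Ш(W)[2] = 0` from `#S ≤ 2`, `#S′ ≤ 4`, rank `1` — fact-free, NO `hCT`) ⇒ `BSD(W,2) ⟺ ord₂ #Ш_an = 0`; `K = ℚ(√−2qp)`, a Heegner point (`hnew`),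
`Cd • X₀(49)^{(d_K)} = W`; `#Ш_an = 𝔮₄₉` with ITS `k`, `k = 1` (F1 `not_forall_halvable_twoPrimesTwist_plusPFiveAlpha`, the TYPE-α F12a with `S′ ⊆ {1, −7, p, −7p}`); the optimal datum (`hM`), the trace relation, the factor table.
[cite: Miller2011LMS, Def. 1.1] [cite: GrossZagier1986, Thm. I.(6.3) and V.§2] [cite: BurungaleFlach2024, Cor. 2] [cite: GrossLMS1991, §4 (4.1)] -/
theorem bsdp_two_negTwoPrimesTwist_of_traceHalving_plusPFiveAlpha_sharp
    (hGZ : ∀ (N : ℕ) [NeZero N] (W : WeierstrassCurve ℚ) (K : Type) [Field K] [NumberField K], gross_zagier N W K)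
    (h12 : thm12_fullBSD_twist) (hnew : exists_isNewformOf) (hBF : bsdTriple_of_hasCM_of_L_one_ne_zero)
    (hKo : ∀ (N : ℕ) [NeZero N] (W : WeierstrassCurve ℚ) (K : Type) [Field K] [NumberField K], kolyvagin N W K)
    (hGZK : rank_eq_analyticRank_of_analyticRank_le_one) (hM : OptimalCurveManinCertificate cm7)
    {q p : ℕ} [Fact q.Prime] [Fact p.Prime] (hq8 : q % 8 = 7) (hq7 : jacobiSym q 7 = -1) (hp8 : p % 8 = 5) (hp7 : legendreSym p (-7) = 1)
    (hα : ¬ ∃ x : ZMod p, x ^ 4 = -7) (hpq : jacobiSym p q = 1)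
    (W : WeierstrassCurve ℚ) [W.IsElliptic] [W.IsGloballyMinimal] (C : VariableChange ℚ)
    (hC : C • W = cm7.quadraticTwist ((-2 * ((q : ℤ) * p) : ℤ) : ℚ)) (har : W.analyticRank = 1) (hrk : W.mordellWeilRank = 1)
    (htrace : ∀ (K : Type) [Field K] [NumberField K], IsImaginaryQuadratic K → NumberField.discr K = -(8 * (q : ℤ) * p) →
      ∀ (ι : K →+* ℂ) [FiniteDimensional K (ringClassField K ι 1)] [IsGalois K (ringClassField K ι 1)]
        (D₀ : ModularParametrizationData cm7 49), |D₀.c| = 1 → ∀ (β : ℤ) (d : KolyvaginHeegnerData D₀ β ι 1),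
        ∃ y : (cm7.baseChange K).toAffine.Point,
          Affine.Point.map (W' := cm7) (algebraMap K (ringClassField K ι 1)).toRatAlgHom y =
            ∑ σ : ringClassField K ι 1 ≃ₐ[K] ringClassField K ι 1,
              Affine.Point.map (σ : ringClassField K ι 1 →ₐ[K] ringClassField K ι 1) d.y ∧
          (∃ (N : ℤ) (R₀ : (cm7.baseChange K).toAffine.Point), Odd N ∧ N • y = (2 : ℤ) • R₀) ∧
          ¬ ∃ (S : (cm7.baseChange K).toAffine.Point) (N' : ℤ) (t' : (cm7.baseChange K).toAffine.Point), Odd N' ∧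
              (t' = 0 ∨ t' = Affine.Point.some 2 (-1) (nonsingular_cm7_baseChange_two_neg_one K)) ∧ N' • y = (4 : ℤ) • S + t') :
    BSDp W 2 := by
  haveI : cm7.IsGloballyMinimal := Summit.BirchSwinnertonDyer.Rank1Residual.X12.O11.RouteU.isGloballyMinimal_X049_eq
  have hq : q.Prime := Fact.out
  have hp : p.Prime := Fact.out
  obtain ⟨hq4, -⟩ := mod_eight_seven_arith hq8
  obtain ⟨-, hq2, -, -⟩ := mod_four_three_split hq4
  obtain ⟨hp2, hp7', hp4⟩ := prime_ne_two_ne_seven_of_mod_eight_five hp8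
  obtain ⟨-, hqp, -, -, -⟩ := arith_negEightTwoPrimes_modFour hq4 hp4
  obtain ⟨hodd, hneg⟩ := cells_arith_negEightTwoPrimes_pOne hq4 hp4
  have hpj : jacobiSym p 7 = 1 := by rw [← legendreSym_neg_seven_eq_jacobiSym hp2]; exact hp7
  have hCq : C • W = cm7.quadraticTwist (-(2 * (q : ℚ) * p)) := by rw [hC]; push_cast; ring_nf
  have h2 : ∀ c ∈ W.sha, 2 • c = 0 → c = 0 := (rank_le_one_and_sha_two_twoPrimesTwist_plusPFiveAlpha hq8 hq7 hp8 hp7 hα hpq W C hC).2 hrk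
  obtain ⟨-, hiff⟩ := bsdp_two_iff_shaAn_unit_of_forall_mem_sha W h2 (hrk.trans har.symm)
  ------------------------------------------------------------------ `K = ℚ(√−2qp)`, a Heegner point, `Cd • X₀(49)^{(d_K)} = W`
  have hsq : Squarefree (-(2 * ((q : ℤ) * p))) := squarefree_neg_two_mul_two_primes hq hp hq2 hp2 hqp
  obtain ⟨h4dvd, hmod4, hdiv⟩ := discr_arith_negEight_odd hodd
  obtain ⟨K, _, _, h2K, hdK⟩ := QuadraticFields.Quadratic.exists_numberField_discr_eq (D := 4 * (-(2 * ((q : ℤ) * p))))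
    (Or.inr ⟨h4dvd, hmod4, by rw [hdiv]; exact hsq⟩)
  have hK : IsImaginaryQuadratic K := isImaginaryQuadratic_iff_discr_neg.mpr ⟨h2K, by rw [hdK]; exact hneg⟩
  have hdK' : NumberField.discr K = -(8 * (q : ℤ) * p) := by rw [hdK]; ring
  have hdK8 : NumberField.discr K = -(8 * ((q * p : ℕ) : ℤ)) := by rw [hdK]; push_cast; ring
  haveI : NeZero (cm7.conductorNorm ℤ) := ⟨(cm7.conductorNorm_pos_holds).ne'⟩
  have hH : SatisfiesHeegnerHypothesis 49 K := satisfiesHeegnerHypothesis_fortyNine_negEightTwoPrimes hK hq7 hpj hdK'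
  have hH' : SatisfiesHeegnerHypothesis (cm7.conductorNorm ℤ) K := by rw [conductorNorm_cm7]; exact hH
  obtain ⟨P, hP0⟩ := exists_isHeegnerPoint_of_exists_isNewformOf_of_maninConstant cm7 K hnew
    IsNewformOf.exists_maninConstant_ne_zero_holds hK hH'
  obtain ⟨Dt, H, ι, hPH⟩ := isHeegnerPoint_of_level_eq conductorNorm_cm7 hP0
  obtain ⟨Cd, hCd⟩ := exists_smul_twist_discr_eq_of_smul_eq_twist_negTwo K hdK8 W C (by rw [hC]; push_cast; ring_nf)
  ------------------------------------------------------------------ `#Ш_an = 𝔮₄₉` with ITS `k`, and `k = 1`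
  obtain ⟨-, hrK, -, k, hk12, hkiff, hsha⟩ := shaAn_eq_x049HeegnerTwistQuotient_of_heegner hnew h12 hBF hGZ hKo hGZK K hK hH
    Dt H ι P hPH W Cd hCd har
  have hk1 : k = 1 := by
    rcases hk12 with h | h
    · exact h
    · exact absurd (hkiff.mp h) (not_forall_halvable_twoPrimesTwist_plusPFiveAlpha hK hq8 hq7 hp8 hp7 hα hpq hdK' W C hC hrk)
  rw [hk1] at hsha
  refine hiff.mpr ⟨_, hsha, ?_⟩
  ------------------------------------------------------------------ the trace of the optimal datum: `P = (D₀.c·Dt.c) • y`, `y` halved exactly once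
  obtain ⟨hN, D, -, hD', -⟩ := hM.exists_optimalDatum_abs_maninConstant_eq_one
  haveI := hN
  obtain ⟨D₀, hc⟩ := exists_datum_abs_c_eq_one_of_level_eq conductorNorm_cm7 D hD'
  obtain ⟨d⟩ := exists_kolyvaginHeegnerData_one (phi_heegnerTau_mem_singularModuliField_holds 49 cm7 K) hK D₀ H.β ι H.dvd_sq_sub
  obtain ⟨hfd, hgal⟩ := finiteDimensional_and_isGalois_ringClassField hK ι one_ne_zero
  haveI := hfd
  haveI := hgal
  obtain ⟨y, hy, hhalf, hno4⟩ := htrace K hK hdK' ι D₀ hc H.β d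
  obtain ⟨-, htr⟩ := map_eq_zsmul_sum_algEquiv_of_abs_c_eq_one (heegnerPointOfConductor_one_galoisConj_holds 49 cm7 K) hK hH Dt
    D₀ hc H d hPH
  rw [← hy, ← map_zsmul] at htr
  have hPy : P = (D₀.c * Dt.c) • y :=
    Affine.Point.map_injective (W' := cm7) (f := (algebraMap K (ringClassField K ι 1)).toRatAlgHom) htr
  exact padicValRat_x049Quotient_eq_zero_of_halvingExactlyOnce h12 hK hq hp hq2 hp2 hqp hp7' hq7 hpj hdK' Dt D₀ hc hPy hrK hhalf hno4
    W Cd hCd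

/-- **`BSD(W, 2)` ON CELL a75+ (TYPE α), FROM PRINT + KOLYVAGIN — SEVENTEEN named inputs, NO Cassels–Tate.** For primes `q ≡ 7 (mod 8)` with
`(q/7) = −1`, `p ≡ 5 (mod 8)` with `(−7/p) = +1`, `−7` NOT a fourth power mod `p`, `(p/q) = +1`, and EVERY globally minimal elliptic `W/ℚ` with
`C • W = X₀(49)^{(−2qp)}`: **`BSD(W, 2)`** (Miller's `2`-part), granted EXACTLY: the SIXTEEN prints of the C7A rank axis THEOREM A⁗_α(C7A)
(`hCST hGZ h12 h44 h14 hS31 hnew hM hBT hBF hGZK hEta hEta₀ hD` + `hBCST` + `hpar`; file Z3 `analyticRank_eq_one_twoPrimesTwist_alphaPlusPFive_of_print` ⇒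
`r_an = rank = 1`, and file F2 `trace_halvingExactlyOnce_negEightTwoPrimes_alphaPlusPFive_of_print` = the C7A trace re-export by the χ_Z channel) and Kolyvagin
`hKo` (the Gross–Zagier–Kolyvagin `#Ш_an` bookkeeping). NO `hCT`, NO `h13`. The road: §1's `bsdp_two_negTwoPrimesTwist_of_traceHalving_plusPFiveAlpha_sharp`
(`Ш(W)[2] = 0` by the sharp descent, `k = 1` by F1). Letter-parallel to C7's `bsdp_two_negTwoPrimesTwist_betaPOne_of_print_sharp` (fifteen inputs; there
`h13` in place of `hBT hBCST hpar`). Twist-density ZERO; twin″ (item 19140) is NOT closed; BSD is not proved by any of this; not in print (the C7A cell is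
reached here by the χ_Z channel, not by a published `2`-divisibility theorem).
[cite: Miller2011LMS, Def. 1.1] [cite: GrossZagier1986, Thm. I.(6.3) and V.§2] [cite: CoatesLiTianZhai2015, Thm. 1.2 (p. 359), 1.3, 1.4 and 4.4]
[cite: BurungaleCastellaSkinnerTian2022, Thm. A (p. 326) and Rem. D (p. 327)] [cite: SilvermanAEC2009, Thm. X.4.14] -/
theorem bsdp_two_negTwoPrimesTwist_alphaPlusPFive_of_print_sharp (hCST : thm11_ringClassChar)
    (hGZ : ∀ (N : ℕ) [NeZero N] (W : WeierstrassCurve ℚ) (K : Type) [Field K] [NumberField K], gross_zagier N W K)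
    (h12 : thm12_fullBSD_twist) (h44 : thm44_ord_two_LAlg) (h14 : thm14_rankOne_twist)
    (hS31 : bsdTriple_of_rank_le_one_of_conductor_lt) (hnew : exists_isNewformOf) (hM : OptimalCurveManinCertificate cm7)
    (hBT : burungaleTian_analyticRank_eq_zero_of_selmerCorank_eq_zero_of_hasCM) (hBF : bsdTriple_of_hasCM_of_L_one_ne_zero)
    (hGZK : rank_eq_analyticRank_of_analyticRank_le_one) (hEta : x049_heegner_norm_x_sub_two_not_mem)
    (hEta₀ : x049_x_sub_two_eq_etaQuotient) (hD : deuring_etaQuotient49_heegner_generates_conjPrime)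
    (hBCST : BurungaleCastellaSkinnerTian2022.thmA_analyticRank_eq_one_of_selmerCorank_eq_one)
    (hpar : ∀ (V : WeierstrassCurve ℚ) [V.IsElliptic], p_parity V 2)
    (hKo : ∀ (N : ℕ) [NeZero N] (W : WeierstrassCurve ℚ) (K : Type) [Field K] [NumberField K], kolyvagin N W K)
    {q p : ℕ} (hq : q.Prime) (hq8 : q % 8 = 7) (hq7 : jacobiSym q 7 = -1)
    [Fact p.Prime] (hp8 : p % 8 = 5) (hp7 : legendreSym p (-7) = 1) (hα : ¬ ∃ x : ZMod p, x ^ 4 = -7) (hpq : jacobiSym (p : ℤ) q = 1)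
    (W : WeierstrassCurve ℚ) [W.IsElliptic] [W.IsGloballyMinimal] (C : VariableChange ℚ)
    (hC : C • W = cm7.quadraticTwist (-(2 * (q : ℚ) * p))) : BSDp W 2 := by
  haveI := Fact.mk hq
  obtain ⟨har, hrk, -⟩ := analyticRank_eq_one_twoPrimesTwist_alphaPlusPFive_of_print hCST hGZ h12 h44 h14 hS31 hnew hM hBT hBF hGZK hEta hEta₀ hD
    hBCST hpar hq hq8 hq7 hp8 hp7 hα hpq W C hC
  have hC' : C • W = cm7.quadraticTwist ((-2 * ((q : ℤ) * p) : ℤ) : ℚ) := by rw [hC]; push_cast; ring_nf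
  exact bsdp_two_negTwoPrimesTwist_of_traceHalving_plusPFiveAlpha_sharp hGZ h12 hnew hBF hKo hGZK hM hq8 hq7 hp8 hp7 hα hpq W C
    hC' har hrk fun K _ _ hK hdK ι _ _ D₀ hc β d ↦ trace_halvingExactlyOnce_negEightTwoPrimes_alphaPlusPFive_of_print hCST hGZ h12 h44 h14
      hS31 hnew hM hBT hBF hGZK hEta hEta₀ hD hBCST hpar hq hq8 hq7 hp8 hp7 hα hpq hK hdK ι D₀ hc d

end ClosersPFive

/-! ## §3 U⁺: `BSD(W, 2)` on OBJECT A7⁺ = a71+ ∪ a75+ as ONE statement (`p ≡ 1 (mod 4)`), by name -/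
section UnionPlus

variable (hCST : thm11_ringClassChar)
  (hGZ : ∀ (N : ℕ) [NeZero N] (W : WeierstrassCurve ℚ) (K : Type) [Field K] [NumberField K], gross_zagier N W K)
  (h12 : thm12_fullBSD_twist) (h44 : thm44_ord_two_LAlg) (h14 : thm14_rankOne_twist)
  (hS31 : bsdTriple_of_rank_le_one_of_conductor_lt) (hnew : exists_isNewformOf) (hM : OptimalCurveManinCertificate cm7)
  (hBT : burungaleTian_analyticRank_eq_zero_of_selmerCorank_eq_zero_of_hasCM) (hBF : bsdTriple_of_hasCM_of_L_one_ne_zero)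
  (hGZK : rank_eq_analyticRank_of_analyticRank_le_one) (hEta : x049_heegner_norm_x_sub_two_not_mem)
  (hEta₀ : x049_x_sub_two_eq_etaQuotient) (hD : deuring_etaQuotient49_heegner_generates_conjPrime)
  (hBCST : BurungaleCastellaSkinnerTian2022.thmA_analyticRank_eq_one_of_selmerCorank_eq_one)
  (hpar : ∀ (V : WeierstrassCurve ℚ) [V.IsElliptic], p_parity V 2)
  (hKo : ∀ (N : ℕ) [NeZero N] (W : WeierstrassCurve ℚ) (K : Type) [Field K] [NumberField K], kolyvagin N W K)
include hCST hGZ h12 h44 h14 hS31 hnew hM hBT hBF hGZK hEta hEta₀ hD hBCST hpar hKo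

/-- **`BSD(W, 2)` ON OBJECT A7⁺ (`p ≡ 1 (mod 4)`, TYPE α, `(p/q) = +1`), FROM PRINT + KOLYVAGIN** — §1 (a71+) and §2 (a75+) by name: for primes
`q ≡ 7 (mod 8)` with `(q/7) = −1`, `p ≡ 1 (mod 4)` with `(−7/p) = +1`, `−7` NOT a fourth power mod `p`, `(p/q) = +1`, and EVERY globally minimal
elliptic `W/ℚ` with `C • W = X₀(49)^{(−2qp)}`: `BSD(W, 2)`. SEVENTEEN named inputs (Z3's SIXTEEN + `hKo`); NO Cassels–Tate, NO `h13`. Twist-density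
ZERO; twin″ (item 19140) is NOT closed; BSD is not proved by any of this. [cite: GrossZagier1986, Thm. I.(6.3)] [cite: Gross1984, §§4–5]
[cite: CoatesLiTianZhai2015, Thm. 1.2, 1.4 and 4.4] -/
theorem bsdp_two_negTwoPrimesTwist_alphaPlus_modFour_of_print_sharp
    {q p : ℕ} (hq : q.Prime) (hq8 : q % 8 = 7) (hq7 : jacobiSym q 7 = -1)
    [Fact p.Prime] (hp4 : p % 4 = 1) (hp7 : legendreSym p (-7) = 1) (hα : ¬ ∃ x : ZMod p, x ^ 4 = -7) (hpq : jacobiSym (p : ℤ) q = 1)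
    (W : WeierstrassCurve ℚ) [W.IsElliptic] [W.IsGloballyMinimal] (C : VariableChange ℚ)
    (hC : C • W = cm7.quadraticTwist (-(2 * (q : ℚ) * p))) : BSDp W 2 := by
  obtain hp8 | hp8 : p % 8 = 1 ∨ p % 8 = 5 := by omega
  · exact bsdp_two_negTwoPrimesTwist_alphaPlusPOne_of_print_sharp hCST hGZ h12 h44 h14 hS31 hnew hM hBT hBF hGZK hEta hEta₀ hD hBCST hpar hKo hq hq8
      hq7 hp8 hp7 hα hpq W C hC
  · exact bsdp_two_negTwoPrimesTwist_alphaPlusPFive_of_print_sharp hCST hGZ h12 h44 h14 hS31 hnew hM hBT hBF hGZK hEta hEta₀ hD hBCST hpar hKo hq hq8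
      hq7 hp8 hp7 hα hpq W C hC

end UnionPlus

end Summit.BirchSwinnertonDyer.BirchSwinnertonDyer.Theorems.GoldfeldGoodTwists

end
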